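import Mathlib.Analysis.SpecialFunctions.Log.Deriv
import Summits.Ventures.CertifiedManyBodySolver.Downfold.PressureAxisDecide
import Literature.MathematicalPhysics.StatisticalMechanics.IsothermalEquationsOfState
import HarnessLib

/-!
# The EOS leg of the P-interval certificate: from a PRESSURE sub-interval to a certified
# LOG-VOLUME spacing, and the margin tests stated on the pressure axis

Venture CertifiedManyBodySolver, cell `pub/hubbard-downfold` (S1 = downfolding front end = ROUTER),
seat hubbard-downfold-mod-2; namespace `Summit.Ventures.CertifiedManyBodySolver.Downfold.Inflation`.

`PressureAxis` / `PressureAxisBox` §2 / `PressureAxisDecide` prove the (b)-margin and one-sided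
guard tests of `router/INFLATION-RULES.md` §P.12 along the LOG-VOLUME axis: a coordinate
`X = exp ∘ f` with sensitivity `|d ln X / d ln V| ≤ S` moves by at most the factor `e^{S·L/2}` from
the hull of its two end values over a sub-interval of log-volume length `L`. The phase map, however,
is indexed by PRESSURE (D-0099 «along this range of pressures»), and every interval row of
`router/P-INTERVALS.md` converts `(P₁, P₂)` into `L = |ln V(P₁)/V(P₂)|` either from the two record
volumes or from an equation of state of record (REFVALS-3 §5: a printed `(B₀, B₀')`, Murnaghan /
Vinet / Birch–Murnaghan by source) — so far in floating point, rounded up by hand. This file makes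
that leg exact:

* §1 THE LOG-COMPRESSION COORDINATE. Along an isotherm the logarithmic volumetric strain
  `c(P) = ln(V₀/V(P))` has `dc/dP = 1/K(P)` with `K = -V dP/dV` the isothermal bulk modulus. For
  ANY law whose modulus is at least `K_min > 0` on `[P₁, P₂]` (hypothesis `0 ≤ c' ≤ 1/K_min`) the
  spacing is certified: `0 ≤ c(P₂) - c(P₁) ≤ (P₂ - P₁)/K_min` (`strain_sub_le_of_deriv_le`), and
  `(P₂ - P₁)/K_max ≤ c(P₂) - c(P₁)` under a ceiling (`le_strain_sub_of_le_deriv`); a stiffer law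
  has the smaller spacing (`strain_sub_le_strain_sub_of_deriv_le`). No equation of state is assumed.
* §2 THE MURNAGHAN CLOSED FORM (the tree's `Literature…murnaghanVolume`, Poirier (4.7), typed by
  lit-3): `murnaghanStrain B₀ B₀' P = (1/B₀') ln(1 + B₀' P/B₀) = ln(V₀/V(P))`
  (`murnaghanStrain_eq_log_div`), derivative `1/(B₀ + B₀' P)` (`hasDerivAt_murnaghanStrain`),
  monotone, and the TWO-POINT SPACING RULE
  `(P₂ - P₁)/(B₀ + B₀' P₂) ≤ c(P₂) - c(P₁) ≤ (P₂ - P₁)/(B₀ + B₀' P₁)` (`murnaghanStrain_sub_le`,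
  `le_murnaghanStrain_sub`), antitone in `B₀` and in `B₀'` (a printed error bar maps to its soft
  corner for the upper bound: `murnaghanStrain_sub_le_of_box`), additive over a grid point with the
  two-step refinement `murnaghanStrain_sub_le_two_step` (left Riemann sum of `1/K`); §3 the generic
  TWO-FLOOR refinement `strain_sub_le_two_floors` (any family's floors at two pressures) and the
  Murnaghan four-step sum `murnaghanStrain_sub_le_four_step` (instance: V (0,30) class law < 0.157).
* The DECISIONS on the pressure axis (the (b)-margin / lower-guard / one-sided reach tests composed with a
  certified spacing bound, the all-in-one modulus-floor and Murnaghan forms) and the ROWS OF RECORD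
  re-certified from the EOS inputs they print are the companion file `PressureAxisEOSDecide`.

Everything is PROVED (Mathlib's mean value inequalities; lit-3's `IsothermalEquationsOfState`).
WHAT THIS IS NOT: a claim about any material — `S`, the guards and the EOS parameters are
SYSTEMATIC (screening-grade) inputs of the rows; a modulus floor `K ≥ K_min` on a pressure range is a
hypothesis the row must print (a `B₀` of record gives it for every law whose modulus does not soften
under compression), not a theorem of this file.
-/

open Set

namespace Summit.Ventures.CertifiedManyBodySolver.Downfold

namespace Inflation

open Literature.MathematicalPhysics.StatisticalMechanics (murnaghanVolume log_div_murnaghanVolume)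

/-! ## §1 The log-compression coordinate: spacing from a bulk-modulus floor / ceiling (EOS-free) -/

/-- **SPACING FROM A MODULUS FLOOR.** A log-compression law `c` continuous on `[P₁, P₂]` with
derivative `c' ≤ 1/K_min` on `(P₁, P₂)` (bulk modulus `K = 1/c' ≥ K_min`) satisfies
`c(P₂) - c(P₁) ≤ (P₂ - P₁)/K_min` (mean value inequality). [folklore] -/
theorem strain_sub_le_of_deriv_le {c c' : ℝ → ℝ} {P₁ P₂ Kmin : ℝ}
    (hcont : ContinuousOn c (Icc P₁ P₂)) (hder : ∀ P ∈ Ioo P₁ P₂, HasDerivAt c (c' P) P)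
    (hK : ∀ P ∈ Ioo P₁ P₂, c' P ≤ 1 / Kmin) (h12 : P₁ ≤ P₂) :
    c P₂ - c P₁ ≤ (P₂ - P₁) / Kmin := by
  have hdiff : DifferentiableOn ℝ c (interior (Icc P₁ P₂)) := by
    rw [interior_Icc]; exact fun z hz => (hder z hz).differentiableAt.differentiableWithinAt
  have hle : ∀ z ∈ interior (Icc P₁ P₂), deriv c z ≤ 1 / Kmin := by
    rw [interior_Icc]; intro z hz; rw [(hder z hz).deriv]; exact hK z hz
  have h := (convex_Icc P₁ P₂).image_sub_le_mul_sub_of_deriv_le hcont hdiff hle P₁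
    (left_mem_Icc.2 h12) P₂ (right_mem_Icc.2 h12) h12
  calc c P₂ - c P₁ ≤ 1 / Kmin * (P₂ - P₁) := h
    _ = (P₂ - P₁) / Kmin := by ring

/-- **SPACING FROM A MODULUS CEILING.** `1/K_max ≤ c'` on `(P₁, P₂)` ⇒
`(P₂ - P₁)/K_max ≤ c(P₂) - c(P₁)`. [folklore] -/
theorem le_strain_sub_of_le_deriv {c c' : ℝ → ℝ} {P₁ P₂ Kmax : ℝ}
    (hcont : ContinuousOn c (Icc P₁ P₂)) (hder : ∀ P ∈ Ioo P₁ P₂, HasDerivAt c (c' P) P)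
    (hK : ∀ P ∈ Ioo P₁ P₂, 1 / Kmax ≤ c' P) (h12 : P₁ ≤ P₂) :
    (P₂ - P₁) / Kmax ≤ c P₂ - c P₁ := by
  have hdiff : DifferentiableOn ℝ c (interior (Icc P₁ P₂)) := by
    rw [interior_Icc]; exact fun z hz => (hder z hz).differentiableAt.differentiableWithinAt
  have hge : ∀ z ∈ interior (Icc P₁ P₂), 1 / Kmax ≤ deriv c z := by
    rw [interior_Icc]; intro z hz; rw [(hder z hz).deriv]; exact hK z hz
  have h := (convex_Icc P₁ P₂).mul_sub_le_image_sub_of_le_deriv hcont hdiff hge P₁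
    (left_mem_Icc.2 h12) P₂ (right_mem_Icc.2 h12) h12
  calc (P₂ - P₁) / Kmax = 1 / Kmax * (P₂ - P₁) := by ring
    _ ≤ c P₂ - c P₁ := h

/-- A log-compression law with `c' ≥ 0` on `(P₁, P₂)` is MONOTONE on `[P₁, P₂]` (compression never
decreases along an isotherm of positive modulus). [folklore] -/
theorem strain_monotoneOn_of_deriv_nonneg {c c' : ℝ → ℝ} {P₁ P₂ : ℝ}
    (hcont : ContinuousOn c (Icc P₁ P₂)) (hder : ∀ P ∈ Ioo P₁ P₂, HasDerivAt c (c' P) P)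
    (hpos : ∀ P ∈ Ioo P₁ P₂, 0 ≤ c' P) : MonotoneOn c (Icc P₁ P₂) :=
  monotoneOn_Icc_of_deriv_nonneg hcont hder hpos

/-- **COMPARISON: a stiffer law has the smaller spacing.** Two laws `c`, `d` on `[P₁, P₂]` with
`c' ≤ d'` pointwise on `(P₁, P₂)` (the modulus of `c` is everywhere at least that of `d`) satisfy
`c(P₂) - c(P₁) ≤ d(P₂) - d(P₁)`. [folklore] -/
theorem strain_sub_le_strain_sub_of_deriv_le {c c' d d' : ℝ → ℝ} {P₁ P₂ : ℝ}
    (hc : ContinuousOn c (Icc P₁ P₂)) (hcd : ∀ P ∈ Ioo P₁ P₂, HasDerivAt c (c' P) P)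
    (hd : ContinuousOn d (Icc P₁ P₂)) (hdd : ∀ P ∈ Ioo P₁ P₂, HasDerivAt d (d' P) P)
    (hcmp : ∀ P ∈ Ioo P₁ P₂, c' P ≤ d' P) (h12 : P₁ ≤ P₂) :
    c P₂ - c P₁ ≤ d P₂ - d P₁ := by
  have hmono : MonotoneOn (fun P => d P - c P) (Icc P₁ P₂) :=
    monotoneOn_Icc_of_deriv_nonneg (f' := fun P => d' P - c' P) (hd.sub hc)
      (fun P hP => (hdd P hP).sub (hcd P hP)) (fun P hP => sub_nonneg.2 (hcmp P hP))
  have h := hmono (left_mem_Icc.2 h12) (right_mem_Icc.2 h12) h12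
  simp only at h
  linarith

/-- **CHANGE OF VARIABLE, pressure ↦ log-compression.** If `c` is monotone on `[P₁, P₂]` and a
property holds at every log-compression `u ∈ [c(P₁), c(P₂)]`, it holds at `c(P)` for every
`P ∈ [P₁, P₂]`. [folklore] -/
theorem forall_pressure_Icc_of_forall_strain_Icc {c : ℝ → ℝ} {P₁ P₂ : ℝ} {Q : ℝ → Prop}
    (hc : MonotoneOn c (Icc P₁ P₂)) (hQ : ∀ u ∈ Icc (c P₁) (c P₂), Q u) :
    ∀ P ∈ Icc P₁ P₂, Q (c P) :=
  fun _ hP => hQ _ (mem_Icc_of_monotoneOn hc hP)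

/-! ## §2 The Murnaghan closed form (Poirier (4.7), `Literature…murnaghanVolume`) -/

/-- The logarithmic volumetric strain along the Murnaghan isotherm,
`c(P) = (1/B₀') ln(1 + B₀' P/B₀)` (`= ln(V₀/V(P))`, `murnaghanStrain_eq_log_div`). [folklore] -/
noncomputable def murnaghanStrain (B₀ B₀' P : ℝ) : ℝ := 1 / B₀' * Real.log (1 + B₀' * P / B₀)

/-- Positivity of the Murnaghan base `1 + B₀' P/B₀` for `B₀ > 0`, `B₀' ≥ 0`, `P ≥ 0`. [folklore] -/
theorem murnaghanBase_pos {B₀ B₀' P : ℝ} (hB₀ : 0 < B₀) (hB : 0 ≤ B₀') (hP : 0 ≤ P) :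
    0 < 1 + B₀' * P / B₀ := by
  have : 0 ≤ B₀' * P / B₀ := div_nonneg (mul_nonneg hB hP) hB₀.le
  linarith

/-- `murnaghanStrain B₀ B₀' P = ln(V₀/V(P))` for the tree's `murnaghanVolume V₀ B₀ B₀' P` (`V₀ > 0`,
`B₀ > 0`, `B₀' ≥ 0`, `P ≥ 0`) — the bridge to lit-3's `log_div_murnaghanVolume`. [folklore] -/
theorem murnaghanStrain_eq_log_div {V₀ B₀ B₀' P : ℝ} (hV₀ : 0 < V₀) (hB₀ : 0 < B₀) (hB : 0 ≤ B₀')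
    (hP : 0 ≤ P) :
    murnaghanStrain B₀ B₀' P = Real.log (V₀ / murnaghanVolume V₀ B₀ B₀' P) := by
  rw [log_div_murnaghanVolume hV₀ (murnaghanBase_pos hB₀ hB hP)]; rfl

/-- `c(0) = 0`. [folklore] -/
theorem murnaghanStrain_zero (B₀ B₀' : ℝ) : murnaghanStrain B₀ B₀' 0 = 0 := by
  simp [murnaghanStrain]

/-- **DERIVATIVE = INVERSE LINEAR MODULUS**: `dc/dP = 1/(B₀ + B₀' P)` at every `P ≥ 0`
(`B₀ > 0`, `B₀' > 0`). [folklore] -/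
theorem hasDerivAt_murnaghanStrain {B₀ B₀' P : ℝ} (hB₀ : 0 < B₀) (hB : 0 < B₀') (hP : 0 ≤ P) :
    HasDerivAt (murnaghanStrain B₀ B₀') (1 / (B₀ + B₀' * P)) P := by
  have hy : 0 < 1 + B₀' * P / B₀ := murnaghanBase_pos hB₀ hB.le hP
  have hbase : HasDerivAt (fun Q : ℝ => 1 + B₀' * Q / B₀) (B₀' / B₀) P := by
    have h1 : HasDerivAt (fun Q : ℝ => B₀' * Q / B₀) (B₀' * 1 / B₀) P :=
      ((hasDerivAt_id P).const_mul B₀').div_const B₀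
    simpa using h1.const_add 1
  have hlog : HasDerivAt (fun Q : ℝ => Real.log (1 + B₀' * Q / B₀))
      ((B₀' / B₀) / (1 + B₀' * P / B₀)) P := hbase.log hy.ne'
  have h := hlog.const_mul (1 / B₀')
  have hrew : 1 / B₀' * ((B₀' / B₀) / (1 + B₀' * P / B₀)) = 1 / (B₀ + B₀' * P) := by
    field_simp
  rw [hrew] at h
  exact h

/-- The derivative is positive and at most `1/(B₀ + B₀' P₁)` to the right of `P₁ ≥ 0`, at least
`1/(B₀ + B₀' P₂)` to the left of `P₂`: `1/(B₀ + B₀' P₂) ≤ 1/(B₀ + B₀' P) ≤ 1/(B₀ + B₀' P₁)` for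
`P₁ ≤ P ≤ P₂` (`B₀ > 0`, `B₀' ≥ 0`, `P₁ ≥ 0`). [folklore] -/
theorem inv_linearModulus_mem_Icc {B₀ B₀' P₁ P₂ P : ℝ} (hB₀ : 0 < B₀) (hB : 0 ≤ B₀') (hP₁ : 0 ≤ P₁)
    (h1 : P₁ ≤ P) (h2 : P ≤ P₂) :
    1 / (B₀ + B₀' * P) ∈ Icc (1 / (B₀ + B₀' * P₂)) (1 / (B₀ + B₀' * P₁)) := by
  have hK₁ : 0 < B₀ + B₀' * P₁ := by nlinarith [mul_nonneg hB hP₁]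
  have hK : B₀ + B₀' * P₁ ≤ B₀ + B₀' * P := by nlinarith [mul_le_mul_of_nonneg_left h1 hB]
  have hK' : B₀ + B₀' * P ≤ B₀ + B₀' * P₂ := by nlinarith [mul_le_mul_of_nonneg_left h2 hB]
  have hKP : 0 < B₀ + B₀' * P := lt_of_lt_of_le hK₁ hK
  exact ⟨one_div_le_one_div_of_le hKP hK', one_div_le_one_div_of_le hK₁ hK⟩

/-- Continuity of the Murnaghan strain on `[P₁, P₂]` for `P₁ ≥ 0`. [folklore] -/
theorem continuousOn_murnaghanStrain {B₀ B₀' P₁ P₂ : ℝ} (hB₀ : 0 < B₀) (hB : 0 < B₀')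
    (hP₁ : 0 ≤ P₁) : ContinuousOn (murnaghanStrain B₀ B₀') (Icc P₁ P₂) := fun _ hP =>
  (hasDerivAt_murnaghanStrain hB₀ hB (hP₁.trans hP.1)).continuousAt.continuousWithinAt

/-- The Murnaghan strain is MONOTONE on `[P₁, P₂]` (`P₁ ≥ 0`). [folklore] -/
theorem murnaghanStrain_monotoneOn {B₀ B₀' P₁ P₂ : ℝ} (hB₀ : 0 < B₀) (hB : 0 < B₀')
    (hP₁ : 0 ≤ P₁) : MonotoneOn (murnaghanStrain B₀ B₀') (Icc P₁ P₂) :=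
  strain_monotoneOn_of_deriv_nonneg (continuousOn_murnaghanStrain hB₀ hB hP₁)
    (fun _ hP => hasDerivAt_murnaghanStrain hB₀ hB (hP₁.trans hP.1.le))
    (fun P hP => by
      have hK : 0 < B₀ + B₀' * P := by nlinarith [mul_nonneg hB.le (hP₁.trans hP.1.le)]
      exact (one_div_pos.2 hK).le)

/-- **TWO-POINT SPACING RULE, upper bound**: `c(P₂) - c(P₁) ≤ (P₂ - P₁)/(B₀ + B₀' P₁)` — the
log-volume spacing of a pressure sub-interval is at most its width over the linear modulus AT THE
LOW END (`B₀ > 0`, `B₀' > 0`, `0 ≤ P₁ ≤ P₂`). [folklore] -/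
theorem murnaghanStrain_sub_le {B₀ B₀' P₁ P₂ : ℝ} (hB₀ : 0 < B₀) (hB : 0 < B₀') (hP₁ : 0 ≤ P₁)
    (h12 : P₁ ≤ P₂) :
    murnaghanStrain B₀ B₀' P₂ - murnaghanStrain B₀ B₀' P₁ ≤ (P₂ - P₁) / (B₀ + B₀' * P₁) :=
  strain_sub_le_of_deriv_le (continuousOn_murnaghanStrain hB₀ hB hP₁)
    (fun _ hP => hasDerivAt_murnaghanStrain hB₀ hB (hP₁.trans hP.1.le))
    (fun _ hP => (inv_linearModulus_mem_Icc hB₀ hB.le hP₁ hP.1.le hP.2.le).2) h12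

/-- **TWO-POINT SPACING RULE, lower bound**: `(P₂ - P₁)/(B₀ + B₀' P₂) ≤ c(P₂) - c(P₁)` (modulus at
the HIGH end). [folklore] -/
theorem le_murnaghanStrain_sub {B₀ B₀' P₁ P₂ : ℝ} (hB₀ : 0 < B₀) (hB : 0 < B₀') (hP₁ : 0 ≤ P₁)
    (h12 : P₁ ≤ P₂) :
    (P₂ - P₁) / (B₀ + B₀' * P₂) ≤ murnaghanStrain B₀ B₀' P₂ - murnaghanStrain B₀ B₀' P₁ :=
  le_strain_sub_of_le_deriv (continuousOn_murnaghanStrain hB₀ hB hP₁)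
    (fun _ hP => hasDerivAt_murnaghanStrain hB₀ hB (hP₁.trans hP.1.le))
    (fun _ hP => (inv_linearModulus_mem_Icc hB₀ hB.le hP₁ hP.1.le hP.2.le).1) h12

/-- The spacing is nonnegative. [folklore] -/
theorem murnaghanStrain_sub_nonneg {B₀ B₀' P₁ P₂ : ℝ} (hB₀ : 0 < B₀) (hB : 0 < B₀') (hP₁ : 0 ≤ P₁)
    (h12 : P₁ ≤ P₂) : 0 ≤ murnaghanStrain B₀ B₀' P₂ - murnaghanStrain B₀ B₀' P₁ := by
  have hK₂ : 0 < B₀ + B₀' * P₂ := by nlinarith [mul_nonneg hB.le (hP₁.trans h12)]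
  exact (div_nonneg (sub_nonneg.2 h12) hK₂.le).trans (le_murnaghanStrain_sub hB₀ hB hP₁ h12)

/-- **THE EOS-FREE FLOOR COVERS THE MURNAGHAN RULE**: `c(P₂) - c(P₁) ≤ (P₂ - P₁)/B₀` — the
zero-pressure modulus alone bounds the spacing (lit-3's `log_div_murnaghanVolume_le` is the case
`P₁ = 0`). [folklore] -/
theorem murnaghanStrain_sub_le_div_B₀ {B₀ B₀' P₁ P₂ : ℝ} (hB₀ : 0 < B₀) (hB : 0 < B₀')
    (hP₁ : 0 ≤ P₁) (h12 : P₁ ≤ P₂) :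
    murnaghanStrain B₀ B₀' P₂ - murnaghanStrain B₀ B₀' P₁ ≤ (P₂ - P₁) / B₀ := by
  refine (murnaghanStrain_sub_le hB₀ hB hP₁ h12).trans ?_
  exact div_le_div_of_nonneg_left (sub_nonneg.2 h12) hB₀ (by nlinarith [mul_nonneg hB.le hP₁])

/-- **ANTITONE IN THE MODULUS**: `B₁ ≤ B₂` ⇒ the `B₂`-law has the smaller spacing on every
`[P₁, P₂]` (`0 < B₁`, `B₀' > 0`, `0 ≤ P₁ ≤ P₂`). [folklore] -/
theorem murnaghanStrain_sub_antitone_bulkModulus {B₁ B₂ B₀' P₁ P₂ : ℝ} (hB₁ : 0 < B₁)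
    (hB12 : B₁ ≤ B₂) (hB : 0 < B₀') (hP₁ : 0 ≤ P₁) (h12 : P₁ ≤ P₂) :
    murnaghanStrain B₂ B₀' P₂ - murnaghanStrain B₂ B₀' P₁ ≤
      murnaghanStrain B₁ B₀' P₂ - murnaghanStrain B₁ B₀' P₁ := by
  have hB₂ : 0 < B₂ := lt_of_lt_of_le hB₁ hB12
  refine strain_sub_le_strain_sub_of_deriv_le (continuousOn_murnaghanStrain hB₂ hB hP₁)
    (fun _ hP => hasDerivAt_murnaghanStrain hB₂ hB (hP₁.trans hP.1.le))
    (continuousOn_murnaghanStrain hB₁ hB hP₁)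
    (fun _ hP => hasDerivAt_murnaghanStrain hB₁ hB (hP₁.trans hP.1.le)) (fun P hP => ?_) h12
  have hP : 0 ≤ P := hP₁.trans hP.1.le
  have hK₁ : 0 < B₁ + B₀' * P := by nlinarith [mul_nonneg hB.le hP]
  exact one_div_le_one_div_of_le hK₁ (by linarith)

/-- **ANTITONE IN `B₀'`**: `b₁ ≤ b₂` ⇒ the `b₂`-law has the smaller spacing (`B₀ > 0`, `0 < b₁`,
`0 ≤ P₁ ≤ P₂`). [folklore] -/
theorem murnaghanStrain_sub_antitone_Bprime {B₀ b₁ b₂ P₁ P₂ : ℝ} (hB₀ : 0 < B₀) (hb₁ : 0 < b₁)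
    (hb12 : b₁ ≤ b₂) (hP₁ : 0 ≤ P₁) (h12 : P₁ ≤ P₂) :
    murnaghanStrain B₀ b₂ P₂ - murnaghanStrain B₀ b₂ P₁ ≤
      murnaghanStrain B₀ b₁ P₂ - murnaghanStrain B₀ b₁ P₁ := by
  have hb₂ : 0 < b₂ := lt_of_lt_of_le hb₁ hb12
  refine strain_sub_le_strain_sub_of_deriv_le (continuousOn_murnaghanStrain hB₀ hb₂ hP₁)
    (fun _ hP => hasDerivAt_murnaghanStrain hB₀ hb₂ (hP₁.trans hP.1.le))
    (continuousOn_murnaghanStrain hB₀ hb₁ hP₁)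
    (fun _ hP => hasDerivAt_murnaghanStrain hB₀ hb₁ (hP₁.trans hP.1.le)) (fun P hP => ?_) h12
  have hP : 0 ≤ P := hP₁.trans hP.1.le
  have hK₁ : 0 < B₀ + b₁ * P := by nlinarith [mul_nonneg hb₁.le hP]
  exact one_div_le_one_div_of_le hK₁ (by nlinarith [mul_le_mul_of_nonneg_right hb12 hP])

/-- **THE PRINTED-ERROR-BAR CORNER RULE (upper bound)**: an EOS of record printed as
`B₀ ≥ B_lo > 0`, `B₀' ≥ b_lo > 0` certifies `c(P₂) - c(P₁) ≤ (P₂ - P₁)/(B_lo + b_lo P₁)` — the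
spacing bound is read at the SOFT corner of the printed box. [folklore] -/
theorem murnaghanStrain_sub_le_of_box {B₀ B₀' Blo blo P₁ P₂ : ℝ} (hBlo : 0 < Blo) (hB : Blo ≤ B₀)
    (hblo : 0 < blo) (hb : blo ≤ B₀') (hP₁ : 0 ≤ P₁) (h12 : P₁ ≤ P₂) :
    murnaghanStrain B₀ B₀' P₂ - murnaghanStrain B₀ B₀' P₁ ≤ (P₂ - P₁) / (Blo + blo * P₁) := by
  have hB₀ : 0 < B₀ := lt_of_lt_of_le hBlo hB
  calc murnaghanStrain B₀ B₀' P₂ - murnaghanStrain B₀ B₀' P₁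
      ≤ murnaghanStrain B₀ blo P₂ - murnaghanStrain B₀ blo P₁ :=
        murnaghanStrain_sub_antitone_Bprime hB₀ hblo hb hP₁ h12
    _ ≤ murnaghanStrain Blo blo P₂ - murnaghanStrain Blo blo P₁ :=
        murnaghanStrain_sub_antitone_bulkModulus hBlo hB hblo hP₁ h12
    _ ≤ (P₂ - P₁) / (Blo + blo * P₁) := murnaghanStrain_sub_le hBlo hblo hP₁ h12

/-- **CORNER RULE (lower bound)**: `B₀ ≤ B_hi`, `B₀' ≤ b_hi` (`B₀ > 0`, `B₀' > 0`) ⇒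
`(P₂ - P₁)/(B_hi + b_hi P₂) ≤ c(P₂) - c(P₁)` — the stiff corner. [folklore] -/
theorem div_le_murnaghanStrain_sub_of_box {B₀ B₀' Bhi bhi P₁ P₂ : ℝ} (hB₀ : 0 < B₀) (hB : B₀ ≤ Bhi)
    (hB' : 0 < B₀') (hb : B₀' ≤ bhi) (hP₁ : 0 ≤ P₁) (h12 : P₁ ≤ P₂) :
    (P₂ - P₁) / (Bhi + bhi * P₂) ≤ murnaghanStrain B₀ B₀' P₂ - murnaghanStrain B₀ B₀' P₁ := by
  have hBhi : 0 < Bhi := lt_of_lt_of_le hB₀ hB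
  have hbhi : 0 < bhi := lt_of_lt_of_le hB' hb
  calc (P₂ - P₁) / (Bhi + bhi * P₂)
      ≤ murnaghanStrain Bhi bhi P₂ - murnaghanStrain Bhi bhi P₁ := le_murnaghanStrain_sub hBhi hbhi hP₁ h12
    _ ≤ murnaghanStrain B₀ bhi P₂ - murnaghanStrain B₀ bhi P₁ :=
        murnaghanStrain_sub_antitone_bulkModulus hB₀ hB hbhi hP₁ h12
    _ ≤ murnaghanStrain B₀ B₀' P₂ - murnaghanStrain B₀ B₀' P₁ :=
        murnaghanStrain_sub_antitone_Bprime hB₀ hB' hb hP₁ h12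

/-- Additivity over an intermediate grid point (telescoping). [folklore] -/
theorem murnaghanStrain_sub_add (B₀ B₀' P₁ P₂ P₃ : ℝ) :
    murnaghanStrain B₀ B₀' P₃ - murnaghanStrain B₀ B₀' P₁ =
      (murnaghanStrain B₀ B₀' P₂ - murnaghanStrain B₀ B₀' P₁)
        + (murnaghanStrain B₀ B₀' P₃ - murnaghanStrain B₀ B₀' P₂) := by ring

/-- **TWO-STEP REFINEMENT** (left Riemann sum of the decreasing integrand `1/K`): for
`0 ≤ P₁ ≤ P₂ ≤ P₃`, `c(P₃) - c(P₁) ≤ (P₂ - P₁)/(B₀ + B₀' P₁) + (P₃ - P₂)/(B₀ + B₀' P₂)` — splitting a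
wide sub-interval tightens the one-step bound. [folklore] -/
theorem murnaghanStrain_sub_le_two_step {B₀ B₀' P₁ P₂ P₃ : ℝ} (hB₀ : 0 < B₀) (hB : 0 < B₀')
    (hP₁ : 0 ≤ P₁) (h12 : P₁ ≤ P₂) (h23 : P₂ ≤ P₃) :
    murnaghanStrain B₀ B₀' P₃ - murnaghanStrain B₀ B₀' P₁ ≤
      (P₂ - P₁) / (B₀ + B₀' * P₁) + (P₃ - P₂) / (B₀ + B₀' * P₂) := by
  rw [murnaghanStrain_sub_add B₀ B₀' P₁ P₂ P₃]
  exact add_le_add (murnaghanStrain_sub_le hB₀ hB hP₁ h12)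
    (murnaghanStrain_sub_le hB₀ hB (hP₁.trans h12) h23)

/-! ## §3 Refinement over intermediate points (left Riemann sums of `1/K`) — tighter certified
spacings for wide sub-intervals (L > 0.06) from floors read at several pressures -/

/-- **GENERIC TWO-FLOOR REFINEMENT**: a log-compression law `c` continuous on `[P₁, P₃]` with
derivative `c'`, a modulus floor `K₁` on `(P₁, P₂)` and `K₂` on `(P₂, P₃)` (`P₁ ≤ P₂ ≤ P₃`) has
spacing `c(P₃) - c(P₁) ≤ (P₂ - P₁)/K₁ + (P₃ - P₂)/K₂` — usable with the Murnaghan, Vinet or BM3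
floors read at `P₁` and `P₂`. [folklore] -/
theorem strain_sub_le_two_floors {c c' : ℝ → ℝ} {P₁ P₂ P₃ K₁ K₂ : ℝ}
    (hcont : ContinuousOn c (Icc P₁ P₃)) (hder : ∀ P ∈ Ioo P₁ P₃, HasDerivAt c (c' P) P)
    (hK₁ : ∀ P ∈ Ioo P₁ P₂, c' P ≤ 1 / K₁) (hK₂ : ∀ P ∈ Ioo P₂ P₃, c' P ≤ 1 / K₂)
    (h12 : P₁ ≤ P₂) (h23 : P₂ ≤ P₃) :
    c P₃ - c P₁ ≤ (P₂ - P₁) / K₁ + (P₃ - P₂) / K₂ := by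
  have hc1 : ContinuousOn c (Icc P₁ P₂) := hcont.mono (Icc_subset_Icc le_rfl h23)
  have hc2 : ContinuousOn c (Icc P₂ P₃) := hcont.mono (Icc_subset_Icc h12 le_rfl)
  have hd1 : ∀ P ∈ Ioo P₁ P₂, HasDerivAt c (c' P) P :=
    fun P hP => hder P ⟨hP.1, lt_of_lt_of_le hP.2 h23⟩
  have hd2 : ∀ P ∈ Ioo P₂ P₃, HasDerivAt c (c' P) P :=
    fun P hP => hder P ⟨lt_of_le_of_lt h12 hP.1, hP.2⟩
  have h1 := strain_sub_le_of_deriv_le hc1 hd1 hK₁ h12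
  have h2 := strain_sub_le_of_deriv_le hc2 hd2 hK₂ h23
  linarith

/-- **MURNAGHAN FOUR-STEP REFINEMENT** (two two-steps chained): for
`0 ≤ P₁ ≤ P₂ ≤ P₃ ≤ P₄ ≤ P₅`,
`c(P₅) - c(P₁) ≤ Σᵢ (Pᵢ₊₁ - Pᵢ)/(B₀ + B₀' Pᵢ)` over the four sub-intervals. [folklore] -/
theorem murnaghanStrain_sub_le_four_step {B₀ B₀' P₁ P₂ P₃ P₄ P₅ : ℝ} (hB₀ : 0 < B₀) (hB : 0 < B₀')
    (hP₁ : 0 ≤ P₁) (h12 : P₁ ≤ P₂) (h23 : P₂ ≤ P₃) (h34 : P₃ ≤ P₄) (h45 : P₄ ≤ P₅) :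
    murnaghanStrain B₀ B₀' P₅ - murnaghanStrain B₀ B₀' P₁ ≤
      (P₂ - P₁) / (B₀ + B₀' * P₁) + (P₃ - P₂) / (B₀ + B₀' * P₂)
        + (P₄ - P₃) / (B₀ + B₀' * P₃) + (P₅ - P₄) / (B₀ + B₀' * P₄) := by
  have hP₃ : 0 ≤ P₃ := hP₁.trans (h12.trans h23)
  have h1 := murnaghanStrain_sub_le_two_step hB₀ hB hP₁ h12 h23
  have h2 := murnaghanStrain_sub_le_two_step hB₀ hB hP₃ h34 h45
  linarith

/-- **V M102 (0,30) — the Murnaghan-class spacing certified by the four-step sum at 7.5-GPa steps**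
(`K₀ 157`, `K′ 7/2`): `L ≤ 7.5/157 + 7.5/183.25 + 7.5/209.5 + 7.5/235.75 < 0.157` — tighter than
the one-step `30/157 = 0.191`, and (by 0.001) still not below the record-pair 0.158 that the row
uses as its sound input. [folklore] -/
theorem v_0_30_murnaghan_four_step_lt :
    (15 / 2 - 0 : ℝ) / (157 + (7 / 2) * 0) + (15 - 15 / 2) / (157 + (7 / 2) * (15 / 2))
      + (45 / 2 - 15) / (157 + (7 / 2) * 15) + (30 - 45 / 2) / (157 + (7 / 2) * (45 / 2)) < 157 / 1000 := by
  norm_num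

end Inflation

end Summit.Ventures.CertifiedManyBodySolver.Downfold
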